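import Summits.CriticalPhenomena.PercolationContinuityZ3.Theorems.PercNearOneGluingNoHeavyLowerTailNineTypeCube

/-!
# Nine-type programme for `Q44b`: the COUNT for every configuration whose H-dependencies avoid types 1, 2

Support file for crux `stmt-CriticalPhenomena-4575` (`Q44b`, GF(2)-rank line of `prim-bnk-1`), seat `prim-bnk-1` gen 19;
memo `run/shared/lean/prim/prim-l12/FROM-prim-bnk-1-gen19-HALL-GRAM-ASSEMBLY.md` §13.

MAIN THEOREM (`NineType.card_le_of_no12_dependencies`): a CONT/COV typed configuration `𝒯` with goods `𝔊` (up-set ⊇ HL/HH-forced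
unions) in which no H-dependency contains a point of type 1 or 2 satisfies `#𝒯 ≤ #𝔊`; in particular (`card_le_of_no_12`) every
configuration with types in `{3,…,9}` — this contains the `{5,7} × {8,9}` clash together with ALL of the types 3, 4, 6.
Same size-ascending greedy and `card_le_card_of_coreps` assembly as `…NineTypePureCount`, with the CUBE detector of
`…NineTypeCube` (cubes over the GOOD cross pairs only), which tolerates impure circuits (type-6/3/4 members).
Pure finite combinatorics; no named facts, no sorries, standard axioms.
-/

namespace Summit.CriticalPhenomena.PercolationContinuityZ3.Theorems

namespace NineType

open Finset

variable {α : Type*} [DecidableEq α] [Fintype α]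

/-- **Cube certificate.**  If the cube detector of `Z × A` is orthogonal to the H-rows of `S` and to the co-rows of `Rc`, and pairs
to `1` with the co-row of `t`, then H-rows of `S` plus co-rows of `Rc` do not represent the L-row of `t`. [this work] -/
theorem cube_certificate (𝔊 : Finset (Finset α))
    (hG : ∀ g ∈ 𝔊, ∀ g' : Finset α, g ⊆ g' → g' ∈ 𝔊)
    (Z A : Finset (Finset α)) (t : Finset α) (S Rc : Finset (Finset α))
    (hS : ∀ s ∈ S, (∑ z ∈ Z, ∑ a ∈ A, (if z ∪ a ∈ 𝔊 ∧ z ∪ a ∪ s = univ then (1 : ZMod 2) else 0)) = 0)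
    (hRc : ∀ r ∈ Rc, (∑ z ∈ Z, ∑ a ∈ A, (if z ∪ a ∈ 𝔊 ∧ z ∪ a ∪ rᶜ = univ then (1 : ZMod 2) else 0)) = 0)
    (ht : (∑ z ∈ Z, ∑ a ∈ A, (if z ∪ a ∈ 𝔊 ∧ z ∪ a ∪ tᶜ = univ then (1 : ZMod 2) else 0)) = 1) :
    ¬ (∀ g ∈ 𝔊, ((#(S.filter (fun s => s ⊆ g)) : ℕ) : ZMod 2)
        + ((#(Rc.filter (fun r => rᶜ ⊆ g)) : ℕ) : ZMod 2) = if tᶜ ⊆ g then 1 else 0) := by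
  intro hrel
  set δ : Finset α → ZMod 2 := fun u => ∑ z ∈ Z, ∑ a ∈ A,
    (if z ∪ a ∈ 𝔊 ∧ z ∪ a ⊆ u then (1 : ZMod 2) else 0) with hδ
  have hsum : ∀ c : Finset α, (∑ u ∈ 𝔊.filter (fun u => c ⊆ u), δ u)
      = ∑ z ∈ Z, ∑ a ∈ A, (if z ∪ a ∈ 𝔊 ∧ z ∪ a ∪ c = univ then (1 : ZMod 2) else 0) :=
    fun c => cube_sum_superset 𝔊 hG Z A c
  -- D := Σ_u δ(u)·(#S(u) + #Rc(u)): via the relation it is Σ_{u ⊇ tᶜ} δ = 1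
  have h1 : ∑ u ∈ 𝔊, δ u * (((#(S.filter (fun s => s ⊆ u)) : ℕ) : ZMod 2)
      + ((#(Rc.filter (fun r => rᶜ ⊆ u)) : ℕ) : ZMod 2)) = 1 := by
    calc ∑ u ∈ 𝔊, δ u * (((#(S.filter (fun s => s ⊆ u)) : ℕ) : ZMod 2)
          + ((#(Rc.filter (fun r => rᶜ ⊆ u)) : ℕ) : ZMod 2))
        = ∑ u ∈ 𝔊, (if tᶜ ⊆ u then δ u else 0) := by
          refine Finset.sum_congr rfl fun u hu => ?_
          rw [hrel u hu]
          by_cases htu : tᶜ ⊆ u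
          · rw [if_pos htu, if_pos htu, mul_one]
          · rw [if_neg htu, if_neg htu, mul_zero]
      _ = ∑ u ∈ 𝔊.filter (fun u => tᶜ ⊆ u), δ u := by rw [Finset.sum_filter]
      _ = 1 := by rw [hsum tᶜ, ht]
  -- directly: the S-part and the Rc-part both vanish
  have h2 : ∑ u ∈ 𝔊, δ u * (((#(S.filter (fun s => s ⊆ u)) : ℕ) : ZMod 2)
      + ((#(Rc.filter (fun r => rᶜ ⊆ u)) : ℕ) : ZMod 2)) = 0 := by
    have hSp : ∑ u ∈ 𝔊, δ u * (((#(S.filter (fun s => s ⊆ u)) : ℕ) : ZMod 2)) = 0 := by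
      calc ∑ u ∈ 𝔊, δ u * (((#(S.filter (fun s => s ⊆ u)) : ℕ) : ZMod 2))
          = ∑ u ∈ 𝔊, ∑ s ∈ S, (if s ⊆ u then δ u else 0) := by
            refine Finset.sum_congr rfl fun u _ => ?_
            rw [card_filter_cast, Finset.mul_sum]
            refine Finset.sum_congr rfl fun s _ => ?_
            by_cases hsu : s ⊆ u
            · rw [if_pos hsu, if_pos hsu, mul_one]
            · rw [if_neg hsu, if_neg hsu, mul_zero]
        _ = ∑ s ∈ S, ∑ u ∈ 𝔊, (if s ⊆ u then δ u else 0) := Finset.sum_comm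
        _ = ∑ s ∈ S, ∑ u ∈ 𝔊.filter (fun u => s ⊆ u), δ u := by
            refine Finset.sum_congr rfl fun s _ => ?_; rw [Finset.sum_filter]
        _ = 0 := Finset.sum_eq_zero fun s hs => by rw [hsum s]; exact hS s hs
    have hRp : ∑ u ∈ 𝔊, δ u * (((#(Rc.filter (fun r => rᶜ ⊆ u)) : ℕ) : ZMod 2)) = 0 := by
      calc ∑ u ∈ 𝔊, δ u * (((#(Rc.filter (fun r => rᶜ ⊆ u)) : ℕ) : ZMod 2))
          = ∑ u ∈ 𝔊, ∑ r ∈ Rc, (if rᶜ ⊆ u then δ u else 0) := by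
            refine Finset.sum_congr rfl fun u _ => ?_
            rw [card_filter_cast, Finset.mul_sum]
            refine Finset.sum_congr rfl fun r _ => ?_
            by_cases hru : rᶜ ⊆ u
            · rw [if_pos hru, if_pos hru, mul_one]
            · rw [if_neg hru, if_neg hru, mul_zero]
        _ = ∑ r ∈ Rc, ∑ u ∈ 𝔊, (if rᶜ ⊆ u then δ u else 0) := Finset.sum_comm
        _ = ∑ r ∈ Rc, ∑ u ∈ 𝔊.filter (fun u => rᶜ ⊆ u), δ u := by
            refine Finset.sum_congr rfl fun r _ => ?_; rw [Finset.sum_filter]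
        _ = 0 := Finset.sum_eq_zero fun r hr => by rw [hsum rᶜ]; exact hRc r hr
    simp only [mul_add, Finset.sum_add_distrib, hSp, hRp, add_zero]
  rw [h2] at h1
  exact zero_ne_one h1

/-- Table fact: a point strictly above a free point is free (CONT). -/
theorem contPairs_free (x y : ℕ) (hx : x = 5 ∨ x = 7) (h : (x, y) ∈ contPairs) : y = 5 ∨ y = 7 := by
  rcases hx with rfl | rfl <;> simp [contPairs] at h <;> omega

/-- **From cube defect data to the count.**  `D` = defects (free points); for each `d ∈ D` an H-dependency `Z ⊔ A` through `d`
inside the basis, with `Z`-types in `{3,…,7}`, `A`-types in `{8,9}` and `d` of maximal cardinality among the free members of `Z`.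
[this work] -/
theorem card_le_of_cubeDefects (𝒯 : Finset (Finset α)) (θ : Finset α → ℕ)
    (hθ : ∀ s ∈ 𝒯, 1 ≤ θ s ∧ θ s ≤ 9)
    (hcont : ∀ s ∈ 𝒯, ∀ s' ∈ 𝒯, s ⊆ s' → (θ s, θ s') ∈ contPairs)
    (hcov : ∀ s ∈ 𝒯, ∀ s' ∈ 𝒯, s ≠ s' → s ∪ s' ≠ univ)
    (𝔊 : Finset (Finset α)) (hG : ∀ g ∈ 𝔊, ∀ g' : Finset α, g ⊆ g' → g' ∈ 𝔊)
    (hHL : ∀ s ∈ 𝒯, ∀ s' ∈ 𝒯, hlOK (θ s) (θ s') = true → s ∪ s'ᶜ ∈ 𝔊)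
    (hHH : ∀ s ∈ 𝒯, ∀ s' ∈ 𝒯, s ≠ s' → hhOK (θ s) (θ s') = true → s ∪ s' ∈ 𝔊)
    (D : Finset (Finset α)) (hD : (D ⊆ 𝒯 ∧ (∀ d ∈ D, θ d = 5 ∨ θ d = 7) ∧
      (∀ 𝒮 ⊆ 𝒯 \ D, 𝒮.Nonempty → ∃ T ∈ 𝔊, Odd #(𝒮.filter (fun S => S ⊆ T))) ∧
      (∀ d ∈ D, ∃ Z A : Finset (Finset α), Z ⊆ insert d (𝒯 \ D) ∧ A ⊆ 𝒯 \ D ∧ d ∈ Z ∧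
        (∀ z ∈ Z, θ z = 3 ∨ θ z = 4 ∨ θ z = 5 ∨ θ z = 6 ∨ θ z = 7) ∧ (∀ a ∈ A, θ a = 8 ∨ θ a = 9) ∧
        (∀ z ∈ Z, (θ z = 5 ∨ θ z = 7) → #z ≤ #d) ∧
        (∀ g ∈ 𝔊, ((#(Z.filter (fun y => y ⊆ g)) : ℕ) : ZMod 2) = ((#(A.filter (fun a => a ⊆ g)) : ℕ) : ZMod 2))))) :
    #𝒯 ≤ #𝔊 := by
  classical
  obtain ⟨hDT, hDfree, hB, hcirc⟩ := hD
  -- degenerate ground type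
  by_cases hα : (univ : Finset α) = ∅
  · by_cases hT : 𝒯 = ∅
    · rw [hT, Finset.card_empty]; exact Nat.zero_le _
    · obtain ⟨s, hs⟩ := Finset.nonempty_iff_ne_empty.2 hT
      have hall : ∀ x ∈ 𝒯, x = univ := fun x _ =>
        Finset.eq_univ_of_forall fun e => absurd (Finset.mem_univ e) (by rw [hα]; exact Finset.notMem_empty e)
      have h1 : #𝒯 ≤ 1 := Finset.card_le_one.2 fun x hx y hy => by rw [hall x hx, hall y hy]
      have hgood : s ∪ sᶜ ∈ 𝔊 := hHL s hs s hs (hlOK_self _ (hθ s hs))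
      exact h1.trans (Finset.one_le_card.2 ⟨_, hgood⟩)
  have hρE : ∀ d ∈ D, dᶜ ∉ 𝒯 := by
    intro d hd hmem
    have hne : d ≠ dᶜ := by
      intro hds
      apply hα
      have h2 : d = univ := by
        have := Finset.union_compl d; rw [← hds, Finset.union_idempotent] at this; exact this
      rw [← Finset.compl_univ, ← h2, ← hds, h2]
    exact hcov d (hDT hd) dᶜ hmem hne (Finset.union_compl d)
  refine card_le_card_of_coreps 𝒯 𝔊 D hDT (fun d => dᶜ) hρE (fun x _ y _ hxy => compl_injective hxy) hB ?_
  intro R hR hRne 𝒮 h𝒮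
  obtain ⟨d, hdR, hdmin⟩ := Finset.exists_min_image R (fun r => #r) hRne
  have hd : d ∈ D := hR hdR
  obtain ⟨Z, A, hZ, hA, hdZ, hZt, hAt, hZle, hdep⟩ := hcirc d hd
  have hZT : Z ⊆ 𝒯 := by
    intro z hz
    rcases Finset.mem_insert.1 (hZ hz) with h | h
    · rw [h]; exact hDT hd
    · exact (Finset.mem_sdiff.1 h).1
  have hAT : A ⊆ 𝒯 := fun a ha => (Finset.mem_sdiff.1 (hA ha)).1
  -- co-row value of the cube detector at a defect r ∈ R: [r ∈ Z]
  have hmaxR : ∀ r ∈ R, ∀ z ∈ Z, r ⊆ z → z = r := by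
    intro r hr z hz hrz
    have hrD : r ∈ D := hR hr
    have hzfree : θ z = 5 ∨ θ z = 7 :=
      contPairs_free _ _ (hDfree r hrD) (hcont r (hDT hrD) z (hZT hz) hrz)
    exact (Finset.eq_of_subset_of_card_le hrz ((hZle z hz hzfree).trans (hdmin r hr))).symm
  have hcorow : ∀ r ∈ R, (∑ z ∈ Z, ∑ a ∈ A, (if z ∪ a ∈ 𝔊 ∧ z ∪ a ∪ rᶜ = univ then (1 : ZMod 2) else 0))
      = if r ∈ Z then 1 else 0 :=
    fun r hr => cube_detector_corow 𝒯 θ 𝔊 hG hHL hHH Z A hZT hAT hZt hAt hdep r (hDT (hR hr)) (hDfree r (hR hr))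
      (hmaxR r hr)
  have hcert := cube_certificate 𝔊 hG Z A d 𝒮 (R.erase d)
    (fun s hs => cube_detector_orthogonal 𝒯 θ hθ hcov 𝔊 hG hHL Z A hZT hAT hZt hAt hdep s (Finset.mem_sdiff.1 (h𝒮 hs)).1)
    (fun r hr => by
      rcases Finset.mem_erase.1 hr with ⟨hrd, hrR⟩
      rw [hcorow r hrR, if_neg]
      intro hrZ
      rcases Finset.mem_insert.1 (hZ hrZ) with h | h
      · exact hrd h
      · exact (Finset.mem_sdiff.1 h).2 (hR hrR))
    (by rw [hcorow d hdR, if_pos hdZ])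
  -- convert into an odd target for 𝒮 ∪ comp(R)
  have hex : ∃ g ∈ 𝔊, ((#(𝒮.filter (fun s => s ⊆ g)) : ℕ) : ZMod 2)
      + ((#((R.erase d).filter (fun r => rᶜ ⊆ g)) : ℕ) : ZMod 2) ≠ if dᶜ ⊆ g then 1 else 0 := by
    by_contra hno
    apply hcert
    intro g hg
    by_contra hneq
    exact hno ⟨g, hg, hneq⟩
  obtain ⟨g, hg, hneq⟩ := hex
  refine ⟨g, hg, ?_⟩
  have hsplit : #(R.filter (fun r => rᶜ ⊆ g)) = #((R.erase d).filter (fun r => rᶜ ⊆ g)) + (if dᶜ ⊆ g then 1 else 0) := by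
    rw [← Finset.insert_erase hdR, Finset.filter_insert]
    by_cases hdg : dᶜ ⊆ g
    · rw [if_pos hdg, if_pos hdg, Finset.card_insert_of_notMem]
      · rw [Finset.insert_erase hdR]
      · intro hmem; exact (Finset.mem_erase.1 (Finset.mem_filter.1 hmem).1).1 rfl
    · rw [if_neg hdg, if_neg hdg, add_zero, Finset.insert_erase hdR]
  rw [hsplit, ← add_assoc]
  have hcast : ((#(𝒮.filter (fun s => s ⊆ g)) + #((R.erase d).filter (fun r => rᶜ ⊆ g)) : ℕ) : ZMod 2)
      ≠ (if dᶜ ⊆ g then 1 else 0) := by push_cast; exact hneq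
  exact odd_add_of_parity_ne _ _ hcast

/-- **Greedy construction of cube defect data** when no H-dependency contains a point of type 1 or 2. [this work] -/
theorem exists_cubeDefects : ∀ (n : ℕ) (𝒯 : Finset (Finset α)) (θ : Finset α → ℕ),
    #(𝒯.filter (fun s => θ s = 5 ∨ θ s = 7)) = n →
    (∀ s ∈ 𝒯, 1 ≤ θ s ∧ θ s ≤ 9) →
    (∀ s ∈ 𝒯, ∀ s' ∈ 𝒯, s ⊆ s' → (θ s, θ s') ∈ contPairs) →
    ∀ (𝔊 : Finset (Finset α)), (∀ g ∈ 𝔊, ∀ g' : Finset α, g ⊆ g' → g' ∈ 𝔊) →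
    (∀ s ∈ 𝒯, ∀ s' ∈ 𝒯, hlOK (θ s) (θ s') = true → s ∪ s'ᶜ ∈ 𝔊) →
    (∀ 𝒮 ⊆ 𝒯, 𝒮.Nonempty → (∀ g ∈ 𝔊, ¬ Odd #(𝒮.filter (fun S => S ⊆ g))) →
        ∀ s ∈ 𝒮, θ s ≠ 1 ∧ θ s ≠ 2) →
    ∃ D : Finset (Finset α), (D ⊆ 𝒯 ∧ (∀ d ∈ D, θ d = 5 ∨ θ d = 7) ∧
      (∀ 𝒮 ⊆ 𝒯 \ D, 𝒮.Nonempty → ∃ T ∈ 𝔊, Odd #(𝒮.filter (fun S => S ⊆ T))) ∧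
      (∀ d ∈ D, ∃ Z A : Finset (Finset α), Z ⊆ insert d (𝒯 \ D) ∧ A ⊆ 𝒯 \ D ∧ d ∈ Z ∧
        (∀ z ∈ Z, θ z = 3 ∨ θ z = 4 ∨ θ z = 5 ∨ θ z = 6 ∨ θ z = 7) ∧ (∀ a ∈ A, θ a = 8 ∨ θ a = 9) ∧
        (∀ z ∈ Z, (θ z = 5 ∨ θ z = 7) → #z ≤ #d) ∧
        (∀ g ∈ 𝔊, ((#(Z.filter (fun y => y ⊆ g)) : ℕ) : ZMod 2) = ((#(A.filter (fun a => a ⊆ g)) : ℕ) : ZMod 2)))) := by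
  intro n
  induction n with
  | zero =>
    intro 𝒯 θ hn hθ hcont 𝔊 hG hHL _
    refine ⟨∅, Finset.empty_subset _, fun d hd => absurd hd (Finset.notMem_empty d), ?_,
      fun d hd => absurd hd (Finset.notMem_empty d)⟩
    intro 𝒮 h𝒮 hne
    rw [Finset.sdiff_empty] at h𝒮
    have hno57 : ¬ ∃ t ∈ 𝒯, θ t = 5 ∨ θ t = 7 := by
      rintro ⟨t, ht, h57⟩
      have : t ∈ 𝒯.filter (fun s => θ s = 5 ∨ θ s = 7) := Finset.mem_filter.2 ⟨ht, h57⟩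
      rw [Finset.card_eq_zero.1 hn] at this
      exact Finset.notMem_empty t this
    have hGup : IsUpperSet (𝔊 : Set (Finset α)) := fun a b hab ha => hG a ha b hab
    exact allH_exists_odd_target 𝒯 θ hθ (fun h => hno57 h.1) hcont 𝔊 hGup hHL 𝒮 h𝒮 hne
  | succ n ih =>
    intro 𝒯 θ hn hθ hcont 𝔊 hG hHL h12
    have hFne : (𝒯.filter (fun s => θ s = 5 ∨ θ s = 7)).Nonempty := by
      rw [← Finset.card_pos, hn]; exact Nat.succ_pos n
    obtain ⟨t, htF, htmax⟩ := Finset.exists_max_image _ (fun s => #s) hFne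
    have ht : t ∈ 𝒯 := (Finset.mem_filter.1 htF).1
    have ht57 : θ t = 5 ∨ θ t = 7 := (Finset.mem_filter.1 htF).2
    set 𝒯' := 𝒯.erase t with h𝒯'
    have hsub : 𝒯' ⊆ 𝒯 := Finset.erase_subset t 𝒯
    have hn' : #(𝒯'.filter (fun s => θ s = 5 ∨ θ s = 7)) = n := by
      have : 𝒯'.filter (fun s => θ s = 5 ∨ θ s = 7) = (𝒯.filter (fun s => θ s = 5 ∨ θ s = 7)).erase t := by
        rw [h𝒯', Finset.filter_erase]
      rw [this, Finset.card_erase_of_mem htF, hn]; rfl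
    obtain ⟨D', hD'T, hD'free, hB', hcirc'⟩ := ih 𝒯' θ hn' (fun s hs => hθ s (hsub hs))
      (fun s hs s' hs' => hcont s (hsub hs) s' (hsub hs')) 𝔊 hG
      (fun s hs s' hs' => hHL s (hsub hs) s' (hsub hs'))
      (fun 𝒮 h𝒮 hne hno => h12 𝒮 (h𝒮.trans hsub) hne hno)
    have htD' : t ∉ D' := fun h => Finset.notMem_erase t 𝒯 (hD'T h)
    have hsd : 𝒯 \ D' = insert t (𝒯' \ D') := by
      ext x
      simp only [Finset.mem_sdiff, Finset.mem_insert, h𝒯', Finset.mem_erase]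
      constructor
      · rintro ⟨hx, hxD⟩
        by_cases hxt : x = t
        · exact Or.inl hxt
        · exact Or.inr ⟨⟨hxt, hx⟩, hxD⟩
      · rintro (hxt | ⟨⟨_, hx⟩, hxD⟩)
        · exact ⟨hxt ▸ ht, hxt ▸ htD'⟩
        · exact ⟨hx, hxD⟩
    by_cases hind : ∀ 𝒮 ⊆ insert t (𝒯' \ D'), 𝒮.Nonempty → ∃ T ∈ 𝔊, Odd #(𝒮.filter (fun S => S ⊆ T))
    · refine ⟨D', hD'T.trans hsub, hD'free, ?_, ?_⟩
      · rw [hsd]; exact hind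
      · intro d hd
        obtain ⟨Z, A, hZ, hA, hdZ, hZt, hAt, hZle, hdep⟩ := hcirc' d hd
        refine ⟨Z, A, ?_, ?_, hdZ, hZt, hAt, hZle, hdep⟩
        · intro y hy
          rcases Finset.mem_insert.1 (hZ hy) with h | h
          · exact Finset.mem_insert.2 (Or.inl h)
          · rw [hsd]; exact Finset.mem_insert.2 (Or.inr (Finset.mem_insert_of_mem h))
        · rw [hsd]; exact fun a ha => Finset.mem_insert_of_mem (hA ha)
    · have hind' : ∃ 𝒮₀ : Finset (Finset α), 𝒮₀ ⊆ insert t (𝒯' \ D') ∧ 𝒮₀.Nonempty ∧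
          ∀ T ∈ 𝔊, ¬ Odd #(𝒮₀.filter (fun S => S ⊆ T)) := by
        by_contra hno
        apply hind
        intro 𝒮 h𝒮 hne
        by_contra hno2
        exact hno ⟨𝒮, h𝒮, hne, fun T hT hodd => hno2 ⟨T, hT, hodd⟩⟩
      obtain ⟨𝒮₀, h𝒮₀, hne₀, hno₀⟩ := hind'
      have h𝒮₀T : 𝒮₀ ⊆ 𝒯 := by
        intro x hx
        rcases Finset.mem_insert.1 (h𝒮₀ hx) with h | h
        · rw [h]; exact ht
        · exact hsub (Finset.mem_sdiff.1 h).1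
      have h12' := h12 𝒮₀ h𝒮₀T hne₀ hno₀
      have ht𝒮₀ : t ∈ 𝒮₀ := by
        by_contra htn
        have hS' : 𝒮₀ ⊆ 𝒯' \ D' := by
          intro x hx
          rcases Finset.mem_insert.1 (h𝒮₀ hx) with h | h
          · exact absurd (h ▸ hx) htn
          · exact h
        obtain ⟨T, hT, hodd⟩ := hB' 𝒮₀ hS' hne₀
        exact hno₀ T hT hodd
      set Z := 𝒮₀.filter (fun s => ¬ (θ s = 8 ∨ θ s = 9)) with hZdef
      set A := 𝒮₀.filter (fun s => θ s = 8 ∨ θ s = 9) with hAdef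
      have hZA : 𝒮₀ = Z ∪ A := by
        rw [hZdef, hAdef, Finset.union_comm]; exact (Finset.filter_union_filter_not_eq _ 𝒮₀).symm
      have hdisj : Disjoint Z A := by
        rw [hZdef, hAdef, disjoint_comm]; exact Finset.disjoint_filter_filter_not 𝒮₀ 𝒮₀ _
      have hbas : 𝒯 \ insert t D' = 𝒯' \ D' := by
        ext x
        simp only [Finset.mem_sdiff, Finset.mem_insert, h𝒯', Finset.mem_erase, not_or]
        tauto
      refine ⟨insert t D', ?_, ?_, ?_, ?_⟩
      · exact Finset.insert_subset ht (hD'T.trans hsub)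
      · intro d hd
        rcases Finset.mem_insert.1 hd with h | h
        · rw [h]; exact ht57
        · exact hD'free d h
      · rw [hbas]; exact hB'
      · intro d hd
        rcases Finset.mem_insert.1 hd with h | h
        · subst h
          refine ⟨Z, A, ?_, ?_, ?_, ?_, ?_, ?_, ?_⟩
          · intro z hz
            rw [hbas]; exact h𝒮₀ (Finset.mem_filter.1 hz).1
          · intro a ha
            rw [hbas]
            have ha𝒮 : a ∈ 𝒮₀ := (Finset.mem_filter.1 ha).1
            rcases Finset.mem_insert.1 (h𝒮₀ ha𝒮) with h | h
            · exfalso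
              rcases (Finset.mem_filter.1 ha).2 with h8 | h9 <;> rcases ht57 with h5 | h7 <;> rw [h] at * <;> omega
            · exact h
          · exact Finset.mem_filter.2 ⟨ht𝒮₀, by rcases ht57 with h | h <;> omega⟩
          · intro z hz
            have hzS : z ∈ 𝒮₀ := (Finset.mem_filter.1 hz).1
            have hn89 : ¬ (θ z = 8 ∨ θ z = 9) := (Finset.mem_filter.1 hz).2
            have h9 := hθ z (h𝒮₀T hzS)
            obtain ⟨hn1, hn2⟩ := h12' z hzS
            omega
          · exact fun a ha => (Finset.mem_filter.1 ha).2
          · intro z hz hzfree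
            have hzT : z ∈ 𝒯 := h𝒮₀T (Finset.mem_filter.1 hz).1
            exact htmax z (Finset.mem_filter.2 ⟨hzT, hzfree⟩)
          · intro g hg
            have hev : ¬ Odd #(𝒮₀.filter (fun S => S ⊆ g)) := hno₀ g hg
            rw [hZA, card_filter_union_of_disjoint Z A hdisj] at hev
            rw [Nat.not_odd_iff_even] at hev
            have h0 : ((#(Z.filter (fun y => y ⊆ g)) : ℕ) : ZMod 2)
                + ((#(A.filter (fun a => a ⊆ g)) : ℕ) : ZMod 2) = 0 := by
              rw [← Nat.cast_add]; exact (ZMod.natCast_eq_zero_iff_even).2 hev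
            have heq : ∀ x y : ZMod 2, x + y = 0 → x = y := by
              intro x y h; fin_cases x <;> fin_cases y <;> first | rfl | exact absurd h (by decide)
            exact heq _ _ h0
        · obtain ⟨Z', A', hZ', hA', hdZ', hZt', hAt', hZle', hdep'⟩ := hcirc' d h
          refine ⟨Z', A', ?_, ?_, hdZ', hZt', hAt', hZle', hdep'⟩
          · rw [hbas]; exact hZ'
          · rw [hbas]; exact hA'

/-- **THEOREM (count when no H-dependency meets types 1, 2).** [this work: cube certificate + greedy + assembly] -/
theorem card_le_of_no12_dependencies (𝒯 : Finset (Finset α)) (θ : Finset α → ℕ)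
    (hθ : ∀ s ∈ 𝒯, 1 ≤ θ s ∧ θ s ≤ 9)
    (hcont : ∀ s ∈ 𝒯, ∀ s' ∈ 𝒯, s ⊆ s' → (θ s, θ s') ∈ contPairs)
    (hcov : ∀ s ∈ 𝒯, ∀ s' ∈ 𝒯, s ≠ s' → s ∪ s' ≠ univ)
    (𝔊 : Finset (Finset α)) (hG : ∀ g ∈ 𝔊, ∀ g' : Finset α, g ⊆ g' → g' ∈ 𝔊)
    (hHL : ∀ s ∈ 𝒯, ∀ s' ∈ 𝒯, hlOK (θ s) (θ s') = true → s ∪ s'ᶜ ∈ 𝔊)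
    (hHH : ∀ s ∈ 𝒯, ∀ s' ∈ 𝒯, s ≠ s' → hhOK (θ s) (θ s') = true → s ∪ s' ∈ 𝔊)
    (h12 : ∀ 𝒮 ⊆ 𝒯, 𝒮.Nonempty → (∀ g ∈ 𝔊, ¬ Odd #(𝒮.filter (fun S => S ⊆ g))) →
      ∀ s ∈ 𝒮, θ s ≠ 1 ∧ θ s ≠ 2) :
    #𝒯 ≤ #𝔊 := by
  obtain ⟨D, hD⟩ := exists_cubeDefects _ 𝒯 θ rfl hθ hcont 𝔊 hG hHL h12
  exact card_le_of_cubeDefects 𝒯 θ hθ hcont hcov 𝔊 hG hHL hHH D hD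

/-- **COROLLARY (no types 1, 2 ⟹ count)**: every CONT/COV configuration with types in `{3,…,9}` — the `{5,7} × {8,9}` clash with
ALL of the types 3, 4, 6 — satisfies `#𝒯 ≤ #𝔊`. [this work] -/
theorem card_le_of_no_12 (𝒯 : Finset (Finset α)) (θ : Finset α → ℕ)
    (hθ : ∀ s ∈ 𝒯, 1 ≤ θ s ∧ θ s ≤ 9)
    (hcont : ∀ s ∈ 𝒯, ∀ s' ∈ 𝒯, s ⊆ s' → (θ s, θ s') ∈ contPairs)
    (hcov : ∀ s ∈ 𝒯, ∀ s' ∈ 𝒯, s ≠ s' → s ∪ s' ≠ univ)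
    (𝔊 : Finset (Finset α)) (hG : ∀ g ∈ 𝔊, ∀ g' : Finset α, g ⊆ g' → g' ∈ 𝔊)
    (hHL : ∀ s ∈ 𝒯, ∀ s' ∈ 𝒯, hlOK (θ s) (θ s') = true → s ∪ s'ᶜ ∈ 𝔊)
    (hHH : ∀ s ∈ 𝒯, ∀ s' ∈ 𝒯, s ≠ s' → hhOK (θ s) (θ s') = true → s ∪ s' ∈ 𝔊)
    (hno : ∀ s ∈ 𝒯, θ s ≠ 1 ∧ θ s ≠ 2) : #𝒯 ≤ #𝔊 :=
  card_le_of_no12_dependencies 𝒯 θ hθ hcont hcov 𝔊 hG hHL hHH (fun _ h𝒮 _ _ s hs => hno s (h𝒮 hs))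

end NineType

end Summit.CriticalPhenomena.PercolationContinuityZ3.Theorems
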